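import Summits.HodgeConjecture.HodgeCM.Automorphic.KernelModelHeisenberg_1

/-! PORT of `HodgeCM/Automorphic/KernelModelHeisenberg.lean` (HodgeCMPerL run 82) — part 2: continuation of `Summits.HodgeConjecture.HodgeCM.Automorphic.KernelModelHeisenberg_1` (split at a top-level declaration boundary by port_pkg.py; scope re-opened below; declarations unchanged). -/

-- port_pkg: scope re-opened for this part (file-level context, then the namespace/section stack open at the cut)
set_option autoImplicit false
noncomputable section
open MeasureTheory Topology
open HodgeCM.PerL34 HodgeCM.PerL34.Annihilation
open scoped RealInnerProductSpace FourierTransform SchwartzMap CompactlySupported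
attribute [-instance] Quotient.instMeasurableSpace
namespace HodgeCM
namespace SchwartzWeil
namespace HeisenbergKernel
attribute [local instance] borelCircle
attribute [local instance] borelT borelSpace_T
section TorusGroup
variable (V : Type) [NormedAddCommGroup V] [InnerProductSpace ℝ V] (L : Submodule ℤ V) (m : ℤ)
/-- (Ported verbatim from the HodgeCMPerL package; no docstring in the source.) -/
theorem mem_Xw {ξ : PontryaginDual ((Multiplicative V × Circle) ⧸ ΛT V L m)} :
    ξ ∈ Xw V L m ↔
      (dualChar ξ).comp ((QuotientGroup.mk' (ΛT V L m)).comp (MonoidHom.inr (Multiplicative V) Circle)) = weightC m :=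
  Iff.rfl

/-- An allowed character factors through its `V`-part and the weight: `ξ(a, u) = ξ(a, 1) · u^{-m}`. -/
theorem dualChar_mk_eq (χ : Xw V L m) (t : Multiplicative V × Circle) :
    dualChar χ.1 (QuotientGroup.mk t : (Multiplicative V × Circle) ⧸ ΛT V L m) =
      dualChar χ.1 (QuotientGroup.mk (t.1, 1)) * ((t.2 ^ (-m) : Circle) : ℂ) := by
  have h : dualChar χ.1 (QuotientGroup.mk ((1 : Multiplicative V), t.2) : (Multiplicative V × Circle) ⧸ ΛT V L m) =
      ((t.2 ^ (-m) : Circle) : ℂ) :=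
    DFunLike.congr_fun χ.2 t.2
  have ht : t = (t.1, 1) * (1, t.2) := (Prod.fst_mul_snd t).symm
  conv_lhs => rw [ht]
  rw [QuotientGroup.mk_mul, map_mul, h]

/-- **The basic allowed character** `χ₀(a, u) = u^{-m}` of `[T]` (trivial on `V ⧸ L`) descends: `uᵐ = 1` on `Λ`. -/
theorem ΛT_le_ker_χ₀Hom : ΛT V L m ≤ (χ₀Hom V m).ker := fun t ht => by
  rw [MonoidHom.mem_ker, χ₀Hom_apply, zpow_neg, ((mem_ΛT V L m).1 ht).2, inv_one]

/-- `χ₀` as a continuous unitary character of `[T]`. -/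
def χ₀ : PontryaginDual ((Multiplicative V × Circle) ⧸ ΛT V L m) where
  toMonoidHom := QuotientGroup.lift (ΛT V L m) (χ₀Hom V m) (ΛT_le_ker_χ₀Hom V L m)
  continuous_toFun := by
    change Continuous fun q => QuotientGroup.lift (ΛT V L m) (χ₀Hom V m) (ΛT_le_ker_χ₀Hom V L m) q
    rw [(QuotientGroup.isQuotientMap_mk (ΛT V L m)).continuous_iff]
    exact (continuous_zpow (-m)).comp continuous_snd

/-- (Ported verbatim from the HodgeCMPerL package; no docstring in the source.) -/
@[simp] theorem dualChar_χ₀_mk (t : Multiplicative V × Circle) :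
    dualChar (χ₀ V L m) (QuotientGroup.mk t) = ((t.2 ^ (-m) : Circle) : ℂ) := rfl

/-- (Ported verbatim from the HodgeCMPerL package; no docstring in the source.) -/
theorem χ₀_mem : χ₀ V L m ∈ Xw V L m := MonoidHom.ext fun _ => rfl

/-- Characters of `[T]` are `L`-PERIODIC in the `V`-variable: `ξ(a, 1) = ξ(a − v, 1)` for `v ∈ L` (as `(v, 1) ∈ Λ`). -/
theorem dualChar_mk_ofAdd_sub (ξ : PontryaginDual ((Multiplicative V × Circle) ⧸ ΛT V L m)) (a : V) {v : V}
    (hv : v ∈ L) :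
    dualChar ξ (QuotientGroup.mk (Multiplicative.ofAdd a, 1) : (Multiplicative V × Circle) ⧸ ΛT V L m) =
      dualChar ξ (QuotientGroup.mk (Multiplicative.ofAdd (a - v), 1)) := by
  have h : (QuotientGroup.mk (Multiplicative.ofAdd a, 1) : (Multiplicative V × Circle) ⧸ ΛT V L m) =
      QuotientGroup.mk (Multiplicative.ofAdd (a - v), 1) := by
    rw [QuotientGroup.eq, mem_ΛT]
    refine ⟨?_, by simp⟩
    simp only [Prod.inv_mk, Prod.mk_mul_mk, toAdd_mul, toAdd_inv, toAdd_ofAdd]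
    have e : -a + (a - v) = -v := by abel
    rw [e]
    exact L.neg_mem hv
  rw [h]

end TorusGroup

section Lattice

variable (V : Type) [NormedAddCommGroup V] [InnerProductSpace ℝ V] [FiniteDimensional ℝ V]
  (L : Submodule ℤ V) [DiscreteTopology L] [IsZLattice ℝ L] (m : ℤ) [NeZero m]

/-- `Λ` is discrete (it embeds into the discrete `arith`). -/
instance discreteTopology_ΛT : DiscreteTopology (ΛT V L m) :=
  DiscreteTopology.of_continuous_injective
    (f := fun t : ΛT V L m => (⟨Heis.ofSchrodinger t.1, t.2⟩ : arith V L m))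
    ((Heis.continuous_ofSchrodinger.comp continuous_subtype_val).subtype_mk _)
    (fun _ _ h => Subtype.ext (ofSchrodinger_injective V (congrArg Subtype.val h)))

/-- `Λ` is countable (discrete in a second countable group; pv09-g4). -/
instance countable_ΛT : Countable (ΛT V L m) := DiscreteFD.countable_of_discrete (ΛT V L m)

/-- `Λ` is closed. -/
theorem isClosed_ΛT : IsClosed (ΛT V L m : Set (Multiplicative V × Circle)) := Subgroup.isClosed_of_discrete

/-- **`[T] = T(𝔸) ⧸ T(L₀) ≅ (V ⧸ L) × (U(1) ⧸ μ_m)` is compact** (a compact set of representatives `C × U(1)`, `C` the closed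
fundamental parallelepiped of `L`, pv14-g5 `exists_isCompact_forall_exists_sub_mem`). -/
instance compactSpace_quot_ΛT : CompactSpace ((Multiplicative V × Circle) ⧸ ΛT V L m) := by
  obtain ⟨C, hC, hcov⟩ := exists_isCompact_forall_exists_sub_mem L
  haveI := isCompact_iff_compactSpace.mp hC
  let f : C × Circle → (Multiplicative V × Circle) ⧸ ΛT V L m :=
    fun p => QuotientGroup.mk (Multiplicative.ofAdd (p.1 : V), p.2)
  have hf : Continuous f := QuotientGroup.continuous_mk.comp
    ((continuous_ofAdd.comp (continuous_subtype_val.comp continuous_fst)).prodMk continuous_snd)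
  have hsurj : Function.Surjective f := by
    intro q
    induction q using QuotientGroup.induction_on with
    | H t =>
      obtain ⟨v, hv, hvC⟩ := hcov (Multiplicative.toAdd t.1)
      refine ⟨(⟨Multiplicative.toAdd t.1 - v, hvC⟩, t.2), ?_⟩
      change (QuotientGroup.mk _ : (Multiplicative V × Circle) ⧸ ΛT V L m) = QuotientGroup.mk t
      rw [QuotientGroup.eq, mem_ΛT]
      refine ⟨?_, ?_⟩
      · simpa only [Prod.fst_mul, Prod.fst_inv, toAdd_mul, toAdd_inv, toAdd_ofAdd, neg_sub, sub_add_cancel] using hv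
      · simp only [Prod.snd_mul, Prod.snd_inv, inv_mul_cancel, one_zpow]
  exact ⟨by rw [← Set.range_eq_univ.mpr hsurj]; exact isCompact_range hf⟩

/-- **A `T(L₀)`-partition of unity on `T(𝔸)`** (PerL v5 l. 405; pv15-g2 `LatticePU.exists_partitionOfUnity_complex`):
`β ∈ C_c(T, ℝ)`, `β ≥ 0`, `Σ_{λ ∈ Λ} β(t λ) = 1`. -/
def β : C_c(Multiplicative V × Circle, ℝ) := (LatticePU.exists_partitionOfUnity_complex (ΛT V L m)).choose

/-- (Ported verbatim from the HodgeCMPerL package; no docstring in the source.) -/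
theorem β_nonneg (t : Multiplicative V × Circle) : 0 ≤ β V L m t :=
  (LatticePU.exists_partitionOfUnity_complex (ΛT V L m)).choose_spec.1 t

/-- (Ported verbatim from the HodgeCMPerL package; no docstring in the source.) -/
theorem β_sum (t : Multiplicative V × Circle) : ∑' a : (ΛT V L m).op, ((β V L m (a • t) : ℝ) : ℂ) = 1 :=
  (LatticePU.exists_partitionOfUnity_complex (ΛT V L m)).choose_spec.2 t

/-- `β` does not vanish identically. -/
theorem exists_β_ne_zero : ∃ t₀ : Multiplicative V × Circle, β V L m t₀ ≠ 0 := by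
  by_contra h
  simp only [not_exists, not_not] at h
  have h1 := β_sum V L m 1
  simp only [h, Complex.ofReal_zero, tsum_zero] at h1
  exact zero_ne_one h1

end Lattice

section Torus

variable (V : Type) [NormedAddCommGroup V] [InnerProductSpace ℝ V] [FiniteDimensional ℝ V] [MeasurableSpace V]
  [BorelSpace V] (L : Submodule ℤ V) [DiscreteTopology L] [IsZLattice ℝ L] (m : ℤ) [NeZero m]
  (Γz : Subgroup Circle) [Finite Γz] (hΓz : ∀ z ∈ Γz, z ^ m = 1)

/-- **The torus-side carrier of the model**: `T(𝔸) := V × U(1)` with Haar measure `ν`, `jT = Heis.ofSchrodinger`, the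
`Λ`-partition of unity `β`, compact torus `T(L₀ ⊗ ℝ) := U(1)` (the centre, `ιc = inr`) with weight `w = u^{-m}`, allowed
characters `X := Xw` (all, `allowed := True`) realised on `T(𝔸)` as `χᵥ ξ = ξ ∘ π`. -/
def torusCarrier : KernelTorusCarrier (core V L m Γz hΓz) (Multiplicative V × Circle) where
  X := Xw V L m
  allowed := fun _ => True
  Tι := Circle
  torus := ⇑((jT V).toMonoidHom.comp (MonoidHom.inr (Multiplicative V) Circle))
  w := ⇑(weightC m)
  ν := Measure.haar
  jT := jT V
  β := β V L m
  χv := fun χ => ⟨fun t => dualChar χ.1 (QuotientGroup.mk t), (continuous_dualChar χ.1).comp QuotientGroup.continuous_mk⟩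

/-- (Ported verbatim from the HodgeCMPerL package; no docstring in the source.) -/
theorem torusCarrier_ν : (torusCarrier V L m Γz hΓz).ν = Measure.haar := rfl

/-- (Ported verbatim from the HodgeCMPerL package; no docstring in the source.) -/
instance isHaarMeasure_ν : (torusCarrier V L m Γz hΓz).ν.IsHaarMeasure := by
  rw [torusCarrier_ν]; infer_instance
/-- (Ported verbatim from the HodgeCMPerL package; no docstring in the source.) -/
instance isFiniteMeasureOnCompacts_ν : IsFiniteMeasureOnCompacts (torusCarrier V L m Γz hΓz).ν := inferInstance
/-- (Ported verbatim from the HodgeCMPerL package; no docstring in the source.) -/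
instance isOpenPosMeasure_ν : (torusCarrier V L m Γz hΓz).ν.IsOpenPosMeasure := inferInstance
/-- (Ported verbatim from the HodgeCMPerL package; no docstring in the source.) -/
instance isMulRightInvariant_ν : (torusCarrier V L m Γz hΓz).ν.IsMulRightInvariant := inferInstance

/-- (Ported verbatim from the HodgeCMPerL package; no docstring in the source.) -/
theorem pt_eq (t : Multiplicative V × Circle) :
    (torusCarrier V L m Γz hΓz).pt t = QuotientGroup.mk (Heis.ofSchrodinger t)⁻¹ := rfl

/-- (Ported verbatim from the HodgeCMPerL package; no docstring in the source.) -/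
@[simp] theorem β_eq : (torusCarrier V L m Γz hΓz).β = β V L m := rfl

/-- (Ported verbatim from the HodgeCMPerL package; no docstring in the source.) -/
@[simp] theorem χv_apply (χ : Xw V L m) (t : Multiplicative V × Circle) :
    (torusCarrier V L m Γz hΓz).χv χ t = dualChar χ.1 (QuotientGroup.mk t) := rfl

/-- **AX5b holds**: every toric period `ϑ_{T,ξ}` is continuous on `𝓢(V, ℂ)` (pv15-g2 `KernelTorusCarrier.AX5b_holds`). -/
theorem AX5b (χ : Xw V L m) : Continuous ((torusCarrier V L m Γz hΓz).ϑc χ) :=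
  (torusCarrier V L m Γz hΓz).AX5b_holds (W V L m Γz hΓz).θ_cont χ

/-- **AX12(i) holds**: `h ↦ ϑ_{T,ξ}(ω(h)Φ)` is continuous on `Heis V` (pv15-g2 `AX12_transl_cont_holds`). -/
theorem AX12_transl_cont (χ : Xw V L m) (Φ : (W V L m Γz hΓz).SK) :
    Continuous fun h => (torusCarrier V L m Γz hΓz).ϑc χ ((core V L m Γz hΓz).omg h Φ) :=
  (torusCarrier V L m Γz hΓz).AX12_transl_cont_holds (W V L m Γz hΓz).θ_omg χ Φ

/-- **The unfolding identity (U) = AX12(ii) holds** in the cocompact Haar model of the nilmanifold `[U(W)] = Heis V ⧸ arith`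
(pv15-g2 `KernelTorusCarrier.AX12_unfold_holds`): `T_Φ(E_ξ f) = ∫_{Heis V} f(h) ϑ_{T,ξ}(ω(h)Φ) dh`. -/
theorem AX12_unfold (Φ : (W V L m Γz hΓz).SK) (χ : Xw V L m)
    (f : CompactlySupportedContinuousMap (Heis V) ℂ) :
    (core V L m Γz hΓz).toRegCoreCarrier.toRepCoreCarrier.toCoreCarrier.TΦ Φ
        ((torusCarrier V L m Γz hΓz).toRegTorusCarrier.E χ f) =
      ∫ h, f h • (core V L m Γz hΓz).toRegCoreCarrier.inclCG
        ((torusCarrier V L m Γz hΓz).toRegTorusCarrier.ϑc χ ((core V L m Γz hΓz).toRegCoreCarrier.omg h Φ))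
          ∂(QH V L m).μ :=
  (torusCarrier V L m Γz hΓz).AX12_unfold_holds (QH V L m).isCocompactHaarModel (W V L m Γz hΓz).θ_omg Φ χ f
    ((torusCarrier V L m Γz hΓz).AX12_transl_cont_holds (W V L m Γz hΓz).θ_omg χ Φ)

/-- The kernel along the torus in carrier notation: `θ_Φ(zΓz, pt t) = uᵐ z⁻ᵐ Σ_{v ∈ L} Φ(v − a)` for `t = (a, u)`. -/
theorem θ_pt (Φ : 𝓢(V, ℂ)) (z : Circle) (t : Multiplicative V × Circle) :
    (core V L m Γz hΓz).θ ⟨Φ, Set.mem_univ Φ⟩ (QuotientGroup.mk z, (torusCarrier V L m Γz hΓz).pt t) =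
      (t.2 : ℂ) ^ m * ((z : ℂ) ^ m)⁻¹ * ∑' v : L, Φ ((v : V) - Multiplicative.toAdd t.1) :=
  centerModel_θ_torus V L m Γz hΓz Φ z t

/-- **The toric period, computed** (PerL (3.9) in the model): for an allowed `ξ` and `Φ ∈ 𝓢(V, ℂ)`,
`ϑ_{T,ξ}(Φ)(zΓz) = z⁻ᵐ ∫_{T(𝔸)} β(t) ξ(a, 1) Σ_{v ∈ L} Φ(v − a) dν(t)` (`t = (a, u)`; the central weights `u^{-m}` of `ξ`
and `uᵐ` of the kernel cancel) — in particular `ϑ_{T,ξ}(Φ)` is a `w`-eigenfunction of the centre: `z ↦ z^{-m} · const`. -/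
theorem ϑc_mk (χ : Xw V L m) (Φ : 𝓢(V, ℂ)) (z : Circle) :
    (torusCarrier V L m Γz hΓz).ϑc χ ⟨Φ, Set.mem_univ Φ⟩ (QuotientGroup.mk z : Circle ⧸ Γz) =
      ((z : ℂ) ^ m)⁻¹ * ∫ t : Multiplicative V × Circle,
        (β V L m t : ℂ) * dualChar χ.1 (QuotientGroup.mk (t.1, 1) : (Multiplicative V × Circle) ⧸ ΛT V L m) *
          ∑' v : L, Φ ((v : V) - Multiplicative.toAdd t.1) ∂(torusCarrier V L m Γz hΓz).ν := by
  rw [KernelTorusCarrier.ϑc_apply, ← integral_const_mul]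
  refine integral_congr_ae (Filter.Eventually.of_forall fun t => ?_)
  change (β V L m t : ℂ) * dualChar χ.1 (QuotientGroup.mk t : (Multiplicative V × Circle) ⧸ ΛT V L m) *
      (core V L m Γz hΓz).θ ⟨Φ, Set.mem_univ Φ⟩ (QuotientGroup.mk z, (torusCarrier V L m Γz hΓz).pt t) = _
  rw [θ_pt, dualChar_mk_eq, Circle.coe_zpow, zpow_neg]
  have hu : ((t.2 : ℂ) ^ m) ≠ 0 := zpow_ne_zero m (Circle.coe_ne_zero t.2)
  calc (β V L m t : ℂ) * (dualChar χ.1 (QuotientGroup.mk (t.1, 1)) * ((t.2 : ℂ) ^ m)⁻¹) *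
        ((t.2 : ℂ) ^ m * ((z : ℂ) ^ m)⁻¹ * ∑' v : L, Φ ((v : V) - Multiplicative.toAdd t.1))
      = (β V L m t : ℂ) * dualChar χ.1 (QuotientGroup.mk (t.1, 1)) * ((((t.2 : ℂ) ^ m)⁻¹ * (t.2 : ℂ) ^ m) *
          (((z : ℂ) ^ m)⁻¹ * ∑' v : L, Φ ((v : V) - Multiplicative.toAdd t.1))) := by ring
    _ = _ := by rw [inv_mul_cancel₀ hu, one_mul]; ring

/-- … and for the basic character `χ₀` at the origin: `ϑ_{T,χ₀}(Φ)(1) = ∫_{T(𝔸)} β(a, u) Σ_{v ∈ L} Φ(v − a) dν`. -/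
theorem ϑc_χ₀_one (Φ : 𝓢(V, ℂ)) :
    (torusCarrier V L m Γz hΓz).ϑc ⟨χ₀ V L m, χ₀_mem V L m⟩ ⟨Φ, Set.mem_univ Φ⟩ (QuotientGroup.mk 1 : Circle ⧸ Γz) =
      ∫ t : Multiplicative V × Circle, (β V L m t : ℂ) * ∑' v : L, Φ ((v : V) - Multiplicative.toAdd t.1)
        ∂(torusCarrier V L m Γz hΓz).ν := by
  rw [ϑc_mk]
  simp only [Circle.coe_one, one_zpow, inv_one, one_mul, dualChar_χ₀_mk, mul_one]

omit [MeasurableSpace V] [BorelSpace V] [IsZLattice ℝ L] in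
/-- A real non-negative Schwartz bump `Φ = φ` whose `L`-periodisation `Σ_{v ∈ L} φ(v − a₀)` at a prescribed `a₀` is EXACTLY `1`
(radius below the isolation constant of `L`, pv14-g4 `exists_norm_lt_imp_eq_zero`). -/
theorem exists_bump (a₀ : V) : ∃ (φ : ContDiffBump (-a₀)) (Φ : 𝓢(V, ℂ)),
    (∀ x, Φ x = ((φ x : ℝ) : ℂ)) ∧ ∑' v : L, φ ((v : V) - a₀) = 1 := by
  obtain ⟨ε, hε, hiso⟩ := exists_norm_lt_imp_eq_zero V L
  let φ : ContDiffBump (-a₀) := ⟨ε / 2, ε, by positivity, by linarith⟩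
  have hs : HasCompactSupport (Complex.ofReal ∘ φ) := φ.hasCompactSupport.comp_left Complex.ofReal_zero
  have hd : ContDiff ℝ ((⊤ : ℕ∞) : WithTop ℕ∞) (Complex.ofReal ∘ φ) :=
    Complex.ofRealCLM.contDiff.comp φ.contDiff
  refine ⟨φ, hs.toSchwartzMap hd, fun _ => rfl, ?_⟩
  rw [tsum_eq_single (0 : L)]
  · rw [ZeroMemClass.coe_zero, zero_sub]
    exact φ.one_of_mem_closedBall (Metric.mem_closedBall_self (le_of_lt φ.rIn_pos))
  · intro v hv
    apply φ.zero_of_le_dist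
    rw [dist_eq_norm, sub_neg_eq_add, sub_add_cancel]
    by_contra h
    exact hv (hiso v (lt_of_not_ge h))

omit [IsZLattice ℝ L] in
/-- The `L`-periodisation `a ↦ Σ_{v ∈ L} Φ(v − a)` is continuous: it is `Θ_Φ` along `(a, 0, 1)` (pv14-g5 `continuous_thetaH`). -/
theorem continuous_periodisation (Φ : 𝓢(V, ℂ)) : Continuous fun a : V => ∑' v : L, Φ ((v : V) - a) := by
  have heq : (fun a : V => ∑' v : L, Φ ((v : V) - a)) =
      fun a => thetaH V L 1 Φ (Heis.ofSchrodinger (Multiplicative.ofAdd a, 1)) := by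
    funext a
    rw [thetaH_eq]
    simp only [Heis.ofSchrodinger_u, Heis.ofSchrodinger_b, Heis.ofSchrodinger_a, Circle.coe_one, one_zpow, one_mul,
      smul_zero, inner_zero_left, AddChar.map_zero_eq_one, toAdd_ofAdd]
  rw [heq]
  exact (continuous_thetaH V L 1 Φ).comp
    (Heis.continuous_ofSchrodinger.comp (continuous_ofAdd.prodMk continuous_const))

/-- **The toric period functional is not zero**: `ϑ_{T,χ₀}(Φ)(1) > 0` for a bump `Φ` centred where `β > 0` (the integrand
`β · Σ_L φ(v − a)` is continuous, compactly supported, `≥ 0` and positive somewhere; Haar measure charges open sets). -/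
theorem ϑc_ne_zero : ∃ Φ : (W V L m Γz hΓz).SK,
    (torusCarrier V L m Γz hΓz).ϑc ⟨χ₀ V L m, χ₀_mem V L m⟩ Φ (QuotientGroup.mk 1 : Circle ⧸ Γz) ≠ 0 := by
  obtain ⟨t₀, ht₀⟩ := exists_β_ne_zero V L m
  obtain ⟨φ, Φ, hΦφ, hP⟩ := exists_bump V L (Multiplicative.toAdd t₀.1)
  refine ⟨⟨Φ, Set.mem_univ Φ⟩, ?_⟩
  -- the integrand is the complexification of the real function `g`
  let g : Multiplicative V × Circle → ℝ := fun t => β V L m t * ∑' v : L, φ ((v : V) - Multiplicative.toAdd t.1)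
  have hPc : ∀ a : V, ∑' v : L, Φ ((v : V) - a) = ((∑' v : L, φ ((v : V) - a) : ℝ) : ℂ) := fun a => by
    rw [Complex.ofReal_tsum]
    exact tsum_congr fun v => hΦφ _
  have hPcont : Continuous fun a : V => ∑' v : L, φ ((v : V) - a) := by
    refine (Complex.continuous_re.comp (continuous_periodisation V L Φ)).congr fun a => ?_
    simp only [Function.comp_apply, hPc, Complex.ofReal_re]
  have hg_cont : Continuous g :=
    (β V L m).continuous.mul (hPcont.comp (continuous_toAdd.comp continuous_fst))
  have hg_supp : HasCompactSupport g := (β V L m).hasCompactSupport.mul_right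
  have hg_nonneg : 0 ≤ g := fun t => mul_nonneg (β_nonneg V L m t) (tsum_nonneg fun v => φ.nonneg)
  have hg_t₀ : g t₀ ≠ 0 := by
    change β V L m t₀ * ∑' v : L, φ ((v : V) - Multiplicative.toAdd t₀.1) ≠ 0
    rw [hP, mul_one]
    exact ht₀
  have hpos : 0 < ∫ t, g t ∂(torusCarrier V L m Γz hΓz).ν :=
    hg_cont.integral_pos_of_hasCompactSupport_nonneg_nonzero hg_supp hg_nonneg hg_t₀
  rw [ϑc_χ₀_one]
  have hint : (∫ t : Multiplicative V × Circle, (β V L m t : ℂ) * ∑' v : L, Φ ((v : V) - Multiplicative.toAdd t.1)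
      ∂(torusCarrier V L m Γz hΓz).ν) = ((∫ t, g t ∂(torusCarrier V L m Γz hΓz).ν : ℝ) : ℂ) := by
    rw [← integral_complex_ofReal]
    refine integral_congr_ae (Filter.Eventually.of_forall fun t => ?_)
    show (β V L m t : ℂ) * ∑' v : L, Φ ((v : V) - Multiplicative.toAdd t.1) =
      ((β V L m t * ∑' v : L, φ ((v : V) - Multiplicative.toAdd t.1) : ℝ) : ℂ)
    rw [hPc, Complex.ofReal_mul]
  rw [hint]
  exact Complex.ofReal_ne_zero.mpr hpos.ne'

omit [MeasurableSpace V] [BorelSpace V] [IsZLattice ℝ L] in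
/-- `exists_bump` with the bump radius ALSO below a prescribed `δ > 0`. -/
theorem exists_bump_le (a₀ : V) {δ : ℝ} (hδ : 0 < δ) : ∃ (φ : ContDiffBump (-a₀)) (Φ : 𝓢(V, ℂ)),
    (∀ x, Φ x = ((φ x : ℝ) : ℂ)) ∧ ∑' v : L, φ ((v : V) - a₀) = 1 ∧ φ.rOut ≤ δ := by
  obtain ⟨ε, hε, hiso⟩ := exists_norm_lt_imp_eq_zero V L
  have hεδ : 0 < min ε δ := lt_min hε hδ
  let φ : ContDiffBump (-a₀) := ⟨min ε δ / 2, min ε δ, by positivity, by linarith⟩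
  have hs : HasCompactSupport (Complex.ofReal ∘ φ) := φ.hasCompactSupport.comp_left Complex.ofReal_zero
  have hd : ContDiff ℝ ((⊤ : ℕ∞) : WithTop ℕ∞) (Complex.ofReal ∘ φ) :=
    Complex.ofRealCLM.contDiff.comp φ.contDiff
  refine ⟨φ, hs.toSchwartzMap hd, fun _ => rfl, ?_, min_le_right ε δ⟩
  rw [tsum_eq_single (0 : L)]
  · rw [ZeroMemClass.coe_zero, zero_sub]
    exact φ.one_of_mem_closedBall (Metric.mem_closedBall_self (le_of_lt φ.rIn_pos))
  · intro v hv
    apply φ.zero_of_le_dist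
    rw [dist_eq_norm, sub_neg_eq_add, sub_add_cancel]
    by_contra h
    exact hv (hiso v (lt_of_lt_of_le (lt_of_not_ge h) (min_le_left ε δ)))

/-- `ϑ_{T,ξ}(Φ)(1) = ∫_{T(𝔸)} β(t) ξ(a, 1) Σ_{v ∈ L} Φ(v − a) dν(t)` for every allowed `ξ`. -/
theorem ϑc_one (χ : Xw V L m) (Φ : 𝓢(V, ℂ)) :
    (torusCarrier V L m Γz hΓz).ϑc χ ⟨Φ, Set.mem_univ Φ⟩ (QuotientGroup.mk 1 : Circle ⧸ Γz) =
      ∫ t : Multiplicative V × Circle,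
        (β V L m t : ℂ) * dualChar χ.1 (QuotientGroup.mk (t.1, 1) : (Multiplicative V × Circle) ⧸ ΛT V L m) *
          ∑' v : L, Φ ((v : V) - Multiplicative.toAdd t.1) ∂(torusCarrier V L m Γz hΓz).ν := by
  rw [ϑc_mk]
  simp only [Circle.coe_one, one_zpow, inv_one, one_mul]


-- port_pkg: scope closed for this part
end Torus
end HeisenbergKernel
end SchwartzWeil
end HodgeCM
end
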